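import Mathlib
import Summits.Ventures.HodgeRepro2.Tier7.Line3.RegularDoubleCosets
import Summits.Ventures.HodgeRepro2.Tier7.Line3.KappaDescent

/-!
# Tier7/Line3/RegOrbDescent — the global invariant of a regular double coset, descended to the fixed field, is
injective: the fields `matO / hiso / κF / hκF / hκ` of `AdaptedData` for `Orb := RegOrb` (seat t7-x1, gen 2)

`RegularDoubleCosets` (p683381) builds the regular double cosets `RegOrb σ f d hP` over the CM-type field `E` with the
invariant `κReg : RegOrb → E`, injective under p1's hypotheses; L1-p5's `KappaDescent.exists_kappa_eq_algebraMap`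
descends p1's invariant of any matrix to the fixed field `F` of an involution `σ : E ≃ₐ[F] E` of a quadratic Galois
extension. This module composes the two: for a regular double coset `c`,
* `κF c : F` := the descended invariant of the chosen representative `matO c` (`hκF : algebraMap F E (κF c) =
  kappa σ d f (matO c)` — the field `hκF` of `AdaptedData`), and
* **`κF_injective`**: `κF` is injective on `RegOrb` (`RegularDoubleCosets.injective_of_descent`) — the field `hκ`;
together with `matO`, `isIsom_matO` (the fields `matO`, `hiso`) this discharges, for `Orb := RegOrb σ f d hP`, every
field of `AdaptedData` that concerns the double cosets and their invariant: only the place data, the support clauses,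
the finite factors, `a₁`, the spectral side and the two hypotheses of the constructor remain displayed.
What stays in words: that the real double cosets `T_A(F) \ U(W_A)(F) / T_B(F)` in the adapted coordinates ARE these
classes (the adapted basis = the §0 data). Nothing about (N) or HC_CM; §8(d): NO.
Blind lane: Mathlib + the HodgeRepro2 prefix only; no sorry; axioms ⊆ {propext, Classical.choice, Quot.sound}.
-/

namespace Summit.Ventures.HodgeRepro2.Tier7.Line3.RegOrbDescent

open Matrix Summit.Ventures.HodgeRepro2.T7SupportTwoTorusInvariant
  Summit.Ventures.HodgeRepro2.T7SupportTwoTorusMatrix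
  Summit.Ventures.HodgeRepro2.Tier7.Line3.RegularDoubleCosets
  Summit.Ventures.HodgeRepro2.Tier7.Line3.KappaDescent

variable {F E : Type*} [Field F] [Field E] [Algebra F E] [IsGalois F E] [FiniteDimensional F E]
  (hrank : Module.finrank F E = 2) (σ : E ≃ₐ[F] E) (hσ1 : σ ≠ 1) (d : Fin 2 → E) (hd : ∀ i, σ (d i) = d i)
  (f : Fin 2 → Fin 2 → E) (hP : IsUnit (basisMat f).det)

/-- the descended invariant of a regular double coset: the element of the fixed field `F` whose image is p1's
invariant of the chosen representative -/
noncomputable def κF (c : RegOrb (σ : E →+* E) f d hP) : F :=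
  Classical.choose (exists_kappa_eq_algebraMap hrank σ hσ1 d hd f (matO (σ : E →+* E) f d hP c))

/-- **the descent identity** (the field `hκF` of `AdaptedData`): `algebraMap F E (κF c) = kappa σ d f (matO c)` -/
theorem hκF (c : RegOrb (σ : E →+* E) f d hP) :
    algebraMap F E (κF hrank σ hσ1 d hd f hP c) = kappa (σ : E →+* E) d f (matO (σ : E →+* E) f d hP c) :=
  Classical.choose_spec (exists_kappa_eq_algebraMap hrank σ hσ1 d hd f (matO (σ : E →+* E) f d hP c))

/-- the descended invariant is the descent of `κReg` -/
theorem algebraMap_κF (c : RegOrb (σ : E →+* E) f d hP) :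
    algebraMap F E (κF hrank σ hσ1 d hd f hP c) = κReg (σ : E →+* E) f d hP c := by
  rw [hκF, kappa_matO]

/-- **the field `hκ`**: the descended invariant is injective on the regular double cosets. -/
theorem κF_injective (hσ : ∀ x, (σ : E →+* E) ((σ : E →+* E) x) = x) (hd0 : ∀ i, d i ≠ 0)
    (hf : herm (σ : E →+* E) d (f 0) (f 1) = 0) (hf0 : disc' (σ : E →+* E) d f 0 ≠ 0)
    (hf1 : disc' (σ : E →+* E) d f 1 ≠ 0) : Function.Injective (κF hrank σ hσ1 d hd f hP) :=
  injective_of_descent (σ : E →+* E) f d hσ hd hd0 hP hf hf0 hf1 (κF hrank σ hσ1 d hd f hP)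
    (algebraMap_κF hrank σ hσ1 d hd f hP)

include hrank in
/-- the involution of a quadratic Galois extension is involutive (`KappaDescent.sigma_sigma`), in the form `κF_injective`
consumes -/
theorem sigma_involutive (x : E) : (σ : E →+* E) ((σ : E →+* E) x) = x :=
  sigma_sigma hrank σ x

/-- **the field `hκ` with the involutivity supplied**: `κF` is injective under the remaining hypotheses on the adapted
pair (non-zero discriminants, orthogonality, an invertible basis matrix). -/
theorem κF_injective' (hd0 : ∀ i, d i ≠ 0) (hf : herm (σ : E →+* E) d (f 0) (f 1) = 0)
    (hf0 : disc' (σ : E →+* E) d f 0 ≠ 0) (hf1 : disc' (σ : E →+* E) d f 1 ≠ 0) :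
    Function.Injective (κF hrank σ hσ1 d hd f hP) :=
  κF_injective hrank σ hσ1 d hd f hP (sigma_involutive hrank σ) hd0 hf hf0 hf1

end Summit.Ventures.HodgeRepro2.Tier7.Line3.RegOrbDescent
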